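import Literature.Geometry.Lorentzian.MGHDUniqueness
import HarnessLib

/-!
# The embedding of one development into another is unique — consequences
# (Sbierski 2016, §3.1, corollary to the first lemma; Choquet-Bruhat–Geroch 1969, Thm. 2–3)

Sbierski, Ann. Henri Poincaré 17 (2016) = arXiv:1309.7591, §3.1, Corollary (to the first lemma):
"Let `(M, g)` be a globally hyperbolic, time oriented Lorentzian manifold with Cauchy surface `Σ`
and `(M', g')` another time oriented Lorentzian manifold. Moreover, say `U₁, U₂ ⊆ M` are open …
and `ψᵢ : Uᵢ → M'`, `i = 1, 2`, are time orientation preserving isometric immersions that agree on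
`Σ`. Then `ψ₁` and `ψ₂` agree on `U₁ ∩ U₂`. *Proof.* Since `ψ₁` and `ψ₂` agree on `Σ`, their
differentials agree on `Σ` … Thus, the differentials of `ψ₁` and `ψ₂` agree on `Σ`. The corollary
now follows from Lemma [isometric immersions are determined by their 1-jet at a point]." This is
the well-definedness behind every gluing step of the construction of the MGHD (ibid., proof of the
existence of the MCGHD: "By Corollary (welldefined) this is well-defined"), and the uniqueness
half of Choquet-Bruhat–Geroch's Theorem 2 (Comm. Math. Phys. 14 (1969), p. 331).

`MGHDUniqueness` proves the global form of this corollary for data embeddings `𝒮₁, 𝒮₂` of the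
same initial data set (`DataEmbedding.eq_of_comp_embed_eq`: two time-orientation preserving
isometric immersions `M₁ → M₂` commuting with the data embeddings are equal — from
`DataEmbedding.mfderiv_eq_mfderiv_of_comp_embed_eq`, `CauchyDevelopmentOneJet`, and the one-jet
rigidity of isometric immersions, O'Neill 1983, Ch. 3, Prop. 3.62, `IsometricImmersionRigidity` /
`IsometricImmersionOneJetRigidity`), together with the uniqueness of the MGHD
(`mghd_unique_cauchy`, with its order-theoretic packaging). This companion file records the
consequences used by the gluing constructions:

* `DataEmbedding.EmbedsInto.unique`, `DataEmbedding.IsIsometricTo.unique` — the witnesses of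
  "extension" and of "isometric as developments" are unique;
* `DataEmbedding.comp_eq_of_comp_embed_eq` — **cocycle / commutativity**: embeddings
  `ψ₁₂ : M₁ → M₂`, `ψ₂₃ : M₂ → M₃`, `ψ₁₃ : M₁ → M₃` of developments necessarily satisfy
  `ψ₂₃ ∘ ψ₁₂ = ψ₁₃` (Choquet-Bruhat–Geroch 1969, p. 333: "By uniqueness, `ψ_αγ = ψ_βγ ψ_αβ`", the
  compatibility used when gluing families of developments; Sbierski 2016, §3.3), and
  `DataEmbedding.eq_of_comp_embed_eq_self` (any two self-embeddings coincide);

No definitions, no named facts.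

## References

* J. Sbierski, *On the existence of a maximal Cauchy development for the Einstein equations: a
  dezornification*, Ann. Henri Poincaré 17 (2016) 301–329 = arXiv:1309.7591, §3.1 (first lemma,
  its corollary, and the well-definedness step in the proof of the existence of the MCGHD), §3.3.
* Y. Choquet-Bruhat, R. Geroch, *Global aspects of the Cauchy problem in general relativity*,
  Comm. Math. Phys. 14 (1969) 329–335, Thm. 2 (p. 331) and p. 333.
* B. O'Neill, *Semi-Riemannian geometry with applications to relativity*, Academic Press 1983,
  Ch. 3, Prop. 3.62.
-/

noncomputable section

open Function Set
open scoped Manifold ContDiff Topology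

namespace Literature.Geometry.Lorentzian

universe u

variable {n : ℕ} {X' : Type u} [TopologicalSpace X'] [ChartedSpace (EuclideanSpace ℝ (Fin n)) X']
  [IsManifold (𝓡 n) ∞ X'] [ConnectedSpace X'] {D : InitialDataSet (𝓡 n) X'}

namespace DataEmbedding

/-- **The witness of "extension" is unique**: if `𝒮₁` embeds into `𝒮₂`, the embedding
`ψ : M₁ → M₂` (smooth, time-orientation preserving, isometric open embedding with `ψ ∘ ι₁ = ι₂`)
is uniquely determined (`eq_of_comp_embed_eq`; openness is not even needed). Sbierski 2016, §3.1,
corollary to the first lemma; Ringström 2009, Def. 16.5. [cite: Sbierski2016AHP, §3.1, corollary to the first lemma] -/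
theorem EmbedsInto.unique {𝒮₁ 𝒮₂ : DataEmbedding D} (h : 𝒮₁.EmbedsInto 𝒮₂) :
    ∃! ψ : 𝒮₁.carrier → 𝒮₂.carrier,
      ContMDiff (𝓡 (n + 1)) (𝓡 (n + 1)) ∞ ψ ∧ Topology.IsOpenEmbedding ψ ∧
        𝒮₁.metric.IsIsometricImmersion 𝒮₂.metric.toPseudoRiemannianMetric ψ ∧
        𝒮₁.timeOrientation.PreservesTimeOrientation ψ 𝒮₂.timeOrientation ∧
        ψ ∘ 𝒮₁.embed = 𝒮₂.embed := by
  obtain ⟨ψ, hψs, hψo, hψi, hψτ, hψι⟩ := h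
  exact ⟨ψ, ⟨hψs, hψo, hψi, hψτ, hψι⟩,
    fun ψ' h' ↦ eq_of_comp_embed_eq 𝒮₁ 𝒮₂ h'.2.2.1 h'.2.2.2.1 h'.2.2.2.2 hψi hψτ hψι⟩

/-- **The isometry between isometric developments is unique** as a map: any two
time-orientation preserving isometric diffeomorphisms `M₁ ≃ M₂` commuting with the data embeddings
coincide (`eq_of_comp_embed_eq` applied to the underlying isometric immersions). Sbierski 2016,
§3.1, corollary to the first lemma; Choquet-Bruhat–Geroch 1969, Thm. 3 ("unique (up to
isometry)"). [cite: Sbierski2016AHP, §3.1, corollary to the first lemma] -/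
theorem IsIsometricTo.unique {𝒮₁ 𝒮₂ : DataEmbedding D}
    (Φ Ψ : Diffeomorph (𝓡 (n + 1)) (𝓡 (n + 1)) 𝒮₁.carrier 𝒮₂.carrier ∞)
    (hΦ : 𝒮₁.metric.IsIsometry 𝒮₂.metric.toPseudoRiemannianMetric Φ ∧
      𝒮₁.timeOrientation.PreservesTimeOrientation Φ 𝒮₂.timeOrientation ∧ Φ ∘ 𝒮₁.embed = 𝒮₂.embed)
    (hΨ : 𝒮₁.metric.IsIsometry 𝒮₂.metric.toPseudoRiemannianMetric Ψ ∧
      𝒮₁.timeOrientation.PreservesTimeOrientation Ψ 𝒮₂.timeOrientation ∧ Ψ ∘ 𝒮₁.embed = 𝒮₂.embed) :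
    Φ = Ψ :=
  Diffeomorph.ext (congrFun (eq_of_comp_embed_eq 𝒮₁ 𝒮₂ ⟨Φ.contMDiff, hΦ.1⟩ hΦ.2.1 hΦ.2.2
    ⟨Ψ.contMDiff, hΨ.1⟩ hΨ.2.1 hΨ.2.2))

/-- **Embeddings of developments compose compatibly** (the cocycle condition of the gluing
constructions; Choquet-Bruhat–Geroch 1969, p. 333: the union of a chain of developments along the
transition isometries; Sbierski 2016, §3.3): if `ψ₁₂ : M₁ → M₂`, `ψ₂₃ : M₂ → M₃` and `ψ₁₃ : M₁ → M₃`
are time-orientation preserving isometric immersions commuting with the data embeddings, then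
`ψ₂₃ ∘ ψ₁₂ = ψ₁₃` — the composite is again such a map (`IsIsometricImmersion.comp`,
`PreservesTimeOrientation.comp`) and such maps are unique (`eq_of_comp_embed_eq`).
[cite: ChoquetBruhatGeroch1969CMP, Thm. 3, proof (p. 333)] -/
theorem comp_eq_of_comp_embed_eq (𝒮₁ 𝒮₂ 𝒮₃ : DataEmbedding D)
    {ψ₁₂ : 𝒮₁.carrier → 𝒮₂.carrier} {ψ₂₃ : 𝒮₂.carrier → 𝒮₃.carrier}
    {ψ₁₃ : 𝒮₁.carrier → 𝒮₃.carrier}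
    (h₁₂i : 𝒮₁.metric.IsIsometricImmersion 𝒮₂.metric.toPseudoRiemannianMetric ψ₁₂)
    (h₁₂τ : 𝒮₁.timeOrientation.PreservesTimeOrientation ψ₁₂ 𝒮₂.timeOrientation)
    (h₁₂ι : ψ₁₂ ∘ 𝒮₁.embed = 𝒮₂.embed)
    (h₂₃i : 𝒮₂.metric.IsIsometricImmersion 𝒮₃.metric.toPseudoRiemannianMetric ψ₂₃)
    (h₂₃τ : 𝒮₂.timeOrientation.PreservesTimeOrientation ψ₂₃ 𝒮₃.timeOrientation)
    (h₂₃ι : ψ₂₃ ∘ 𝒮₂.embed = 𝒮₃.embed)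
    (h₁₃i : 𝒮₁.metric.IsIsometricImmersion 𝒮₃.metric.toPseudoRiemannianMetric ψ₁₃)
    (h₁₃τ : 𝒮₁.timeOrientation.PreservesTimeOrientation ψ₁₃ 𝒮₃.timeOrientation)
    (h₁₃ι : ψ₁₃ ∘ 𝒮₁.embed = 𝒮₃.embed) : ψ₂₃ ∘ ψ₁₂ = ψ₁₃ :=
  eq_of_comp_embed_eq 𝒮₁ 𝒮₃ (h₂₃i.comp h₁₂i)
    (h₂₃τ.comp h₁₂τ h₂₃i.2 (h₂₃i.1.mdifferentiable (by simp)) (h₁₂i.1.mdifferentiable (by simp)))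
    (by rw [comp_assoc, h₁₂ι, h₂₃ι]) h₁₃i h₁₃τ h₁₃ι

/-- **Any two self-embeddings of a development coincide** (the case `𝒮₁ = 𝒮₂` of
`eq_of_comp_embed_eq`; with `φ₂ = id` this is the rigidity `DataEmbedding.eq_id_of_comp_embed_eq'`
of `MGHDUniqueness`): the automorphism group of a development, as a development, is trivial.
Choquet-Bruhat–Geroch 1969, proof of Thm. 3 (p. 332). [cite: ChoquetBruhatGeroch1969CMP, Thm. 3, proof (p. 332)] -/
theorem eq_of_comp_embed_eq_self (𝒮 : DataEmbedding D) {φ₁ φ₂ : 𝒮.carrier → 𝒮.carrier}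
    (h₁i : 𝒮.metric.IsIsometricImmersion 𝒮.metric.toPseudoRiemannianMetric φ₁)
    (h₁τ : 𝒮.timeOrientation.PreservesTimeOrientation φ₁ 𝒮.timeOrientation)
    (h₁ι : φ₁ ∘ 𝒮.embed = 𝒮.embed)
    (h₂i : 𝒮.metric.IsIsometricImmersion 𝒮.metric.toPseudoRiemannianMetric φ₂)
    (h₂τ : 𝒮.timeOrientation.PreservesTimeOrientation φ₂ 𝒮.timeOrientation)
    (h₂ι : φ₂ ∘ 𝒮.embed = 𝒮.embed) : φ₁ = φ₂ :=
  eq_of_comp_embed_eq 𝒮 𝒮 h₁i h₁τ h₁ι h₂i h₂τ h₂ι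

end DataEmbedding

end Literature.Geometry.Lorentzian

end
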